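/-
Copyright (c) 2026 the pub-hodgecm-mathlib formalisation cell (harness21).  Prover seat hodgecm-mathlib-K2E3-p14 (g7), Track B «K2-LIT» ∕ h413
(`stmt-HodgeConjecture-24833`), line `K2_E3_EllipticInputs`, unit U12 §11, road (11-2-split-nsc) (owner K2E3-p26 (g0)), brick D109 (iii)∕D112: the Borel KMU
push-forward of `GL₂(F)` is absolutely continuous — the `N = 2` port, token for token, of ★ K2E3-p17 (g7)'s `K2E3GL3BorelKMUDomination`.  2026-09-04.
-/
import Summits.HodgeConjecture.HodgeConjecture.Theorems.K2E3GL2BorelSliceKIntegral       -- ★ (K2E5-p10 (g4)): `lintegral_glInt_sliceFunctional_eq` (the `ℝ≥0∞` Borel-slice identity of `𝔤𝔩₂`)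
import Literature.NumberTheory.Weil1964.GLnHaarOfAddHaar                                  -- ★ `exists_lintegral_gl_eq_mul_lintegral`, `measurableEmbedding_generalLinearGroup_val`, `glDensity_ne_zero_of_isUnit`
import Literature.MeasureTheory.Group.HaarLocalChart                                      -- ★ `isInvInvariant_of_isHaarMeasure` (compact groups)
import Literature.NumberTheory.Automorphic.GLnStandardLeviUnimodular                      -- ★ `isClosed_standardLeviGL`
import HarnessLib

/-!
# K2_E3 road (h413), §11 (11-2-split-nsc) — brick D109 (iii), (AC) shape at `N = 2`: `μ_G(A) = 0 ⇒ (κ ⊗ (ν_T ⊗ μ_N)){(k,t,u) | k⁻¹ (t u) k ∈ A} = 0`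

Cell `pub/hodgecm-mathlib` (D-0151), Track B, seat K2E3-p14 (g7); dealer K2E3-plan (g4) D112 (13:06:56Z), road K2E3-p26 (g0) census 13:03:37Z (iii).  This is the
`GL₂` twin of ★ `K2E3GL3BorelKMUDomination` (K2E3-p17 (g7)), ported token for token: `K = GL₂(𝒪)` (Haar `κ`), `T = standardLeviGL F id` (diagonal torus),
`N = unipotentRadicalGL F id` (`N₂`), slice coordinates `r ∈ F³`, `b(r) = [[r₀, r₁],[0, r₂]]`.  If `μ_G(A) = 0` then (i) `val(A) ⊆ M₂(F)` is null for EVERY additive Haar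
measure of `M₂(F)` (Haar of `GL₂` is `a‖det‖⁻² dμ𝔤`, ★ Weil) — we use the one carried by the chart `y ↦ [[y₁,y₂],[y₀,y₃]]` from `dx^{⊗4}`, so that (ii) the `ℝ≥0∞`
Borel-slice identity ★ `lintegral_glInt_sliceFunctional_eq` (`∫_K ∫_{F³} g(k b(r) k⁻¹) = c ∫_{F⁴} 1[disc ∈ (Fˣ)²](√‖disc‖)⁻¹ g[[y₁,y₂],[y₀,y₃]] dy`, needs
`2 ≠ 0` in `F`) gives `dx³{r | k b(r) k⁻¹ ∈ val A} = 0` for `κ`-a.e. `k`; (iii) `hMU` at the conjugated set, inversion invariance of `κ` and Tonelli, exactly as at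
`N = 3`.  `--supports stmt-HodgeConjecture-24833 --as helper`; THEOREMS ONLY; never imports `Cruxes/…/Lines`.  COUNT-NEUTRAL.
[vanDijk1972, Thm. p. 237] [BernsteinZelevinsky1977, §2.3] [HarishChandra1970, Part V §4 Lemma 22, Part VII §3] [WeilBNT1967, Ch. I §4, Ch. II §5]
HONEST LABEL: HC_CM is proved only modulo the 7 printed citations (2 remaining named inputs: hLiu418 = stmt-HodgeConjecture-24832, h413 = stmt-HodgeConjecture-24833)
until rung 0 closes; count-neutral helper; `hMU` is the sibling port `K2E3GL2BorelLeviUnipotentCoordinates`.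

## Mathlib ∕ tree search
Tree: ★ `K2E3GL2BorelSliceKIntegral.lintegral_glInt_sliceFunctional_eq`, ★ `Weil1964.GLnHaarOfAddHaar.{exists_lintegral_gl_eq_mul_lintegral, measurableEmbedding_generalLinearGroup_val,
measurable_glDensity, glDensity_ne_zero_of_isUnit}`, ★ `HaarLocalChart.isInvInvariant_of_isHaarMeasure`, ★ `isClosed_standardLeviGL`, ★ `isClosed_unipotentRadicalGL`, ★ `isCompact_glInt`,
★ (template) `K2E3GL3BorelKMUDomination`.  Mathlib: `AddEquiv.isAddHaarMeasure_map`, `measure_prod_null_of_ae_null`, `lintegral_prod`, `lintegral_eq_zero_iff`,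
`Measurable.lintegral_prod_right'`, `Measure.inv_apply`, `Measure.inv_eq_self`, `lintegral_indicator_one`, `Measure.restrict_eq_zero`.  Dedup: `rg "borelKMU" Theorems/K2E3GL2*` — none.

## References
* [vanDijk1972] G. van Dijk, *Computation of certain induced characters of 𝔭-adic groups*, Math. Ann. 199 (1972), 229–240.
* [BernsteinZelevinsky1977] I. N. Bernstein, A. V. Zelevinsky, *Induced representations of reductive 𝔭-adic groups I*, Ann. Sci. ÉNS 10 (1977), §2.3.
* [HarishChandra1970] Harish-Chandra (van Dijk), *Harmonic Analysis on Reductive p-adic Groups*, LNM 162 (1970), Part V §4, Part VII §3.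
* [WeilBNT1967] A. Weil, *Basic Number Theory* (1967), Ch. I §4, Ch. II §5.
-/

set_option autoImplicit false
set_option linter.dupNamespace false

noncomputable section

open MeasureTheory MeasureTheory.Measure Set Function Topology Filter Matrix
open scoped NNReal ENNReal MatrixGroups Pointwise
open Literature.NumberTheory.GaloisRepresentations Literature.NumberTheory.GaloisRepresentations.IsNonarchimedeanLocalField
open Literature.NumberTheory.Automorphic Literature.NumberTheory.Automorphic.LocalFieldHaar Literature.NumberTheory.Weil1964

namespace Summit.HodgeConjecture.HodgeConjecture.Cruxes.H413.K2E3GL2BorelKMUDomination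

variable {F : Type*} [Field F] [ValuativeRel F] [TopologicalSpace F] [IsNonarchimedeanLocalField F]
variable [MeasurableSpace F] [BorelSpace F] [MeasurableSpace (GL (Fin 2) F)] [BorelSpace (GL (Fin 2) F)]
  [MeasurableSpace (Matrix (Fin 2) (Fin 2) F)] [BorelSpace (Matrix (Fin 2) (Fin 2) F)]

omit [MeasurableSpace F] [BorelSpace F] in
/-- **A Haar-null set of `GL₂(F)` has `μ𝔤`-null image in `M₂(F)`** (every Haar measure of `GL₂(F)` is `a·‖det‖⁻² dμ𝔤` through `Units.val`, ★ Weil, and the density does not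
vanish on invertible matrices). [cite: WeilBNT1967, Ch. I §4] -/
theorem addHaar_image_val_eq_zero_of_haar_eq_zero (μ𝔤 : Measure (Matrix (Fin 2) (Fin 2) F)) [μ𝔤.IsAddHaarMeasure]
    (μG : Measure (GL (Fin 2) F)) [μG.IsHaarMeasure] {A : Set (GL (Fin 2) F)} (hA : MeasurableSet A) (hA0 : μG A = 0) :
    μ𝔤 (Units.val '' A) = 0 := by
  classical
  have hme : MeasurableEmbedding (Units.val : GL (Fin 2) F → Matrix (Fin 2) (Fin 2) F) := measurableEmbedding_generalLinearGroup_val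
  set E : Set (Matrix (Fin 2) (Fin 2) F) := Units.val '' A with hE
  have hEm : MeasurableSet E := hme.measurableSet_image.2 hA
  obtain ⟨a, ha, hW⟩ := exists_lintegral_gl_eq_mul_lintegral μ𝔤 μG
  -- `∫ 1_E(↑g) dμG = μG A = 0`
  have hpre : (Units.val : GL (Fin 2) F → Matrix (Fin 2) (Fin 2) F) ⁻¹' E = A := by
    ext g
    simp only [hE, mem_preimage, mem_image]
    exact ⟨fun ⟨g', hg', hgg'⟩ => Units.ext hgg' ▸ hg', fun hg => ⟨g, hg, rfl⟩⟩
  have hL : ∫⁻ g : GL (Fin 2) F, E.indicator (1 : Matrix (Fin 2) (Fin 2) F → ℝ≥0∞) (g : Matrix (Fin 2) (Fin 2) F) ∂μG = 0 := by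
    have h : (fun g : GL (Fin 2) F => E.indicator (1 : Matrix (Fin 2) (Fin 2) F → ℝ≥0∞) (g : Matrix (Fin 2) (Fin 2) F)) =
        ((Units.val : GL (Fin 2) F → Matrix (Fin 2) (Fin 2) F) ⁻¹' E).indicator 1 := by
      funext g
      exact (Set.indicator_comp_right (Units.val : GL (Fin 2) F → Matrix (Fin 2) (Fin 2) F) (g := (1 : Matrix (Fin 2) (Fin 2) F → ℝ≥0∞))).symm
    rw [h, lintegral_indicator_one (hEm.preimage hme.measurable), hpre, hA0]
  -- hence `∫_{unit} 1_E · dens dμ𝔤 = 0`, i.e. `(μ𝔤.withDensity dens) E = 0`, and `dens ≠ 0` on `E`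
  have hR : ∫⁻ X in {X : Matrix (Fin 2) (Fin 2) F | IsUnit X}, E.indicator (1 : Matrix (Fin 2) (Fin 2) F → ℝ≥0∞) X *
      ((normAbs F X.det⁻¹ : ℝ≥0) : ℝ≥0∞) ^ Fintype.card (Fin 2) ∂μ𝔤 = 0 := by
    have h := hW (E.indicator 1) (measurable_one.indicator hEm)
    rw [hL] at h
    rcases (mul_eq_zero.1 h.symm) with h0 | h0
    · exact absurd h0 (ENNReal.coe_ne_zero.2 ha.ne')
    · exact h0
  have hEunit : E ⊆ {X : Matrix (Fin 2) (Fin 2) F | IsUnit X} := by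
    rintro _ ⟨g, -, rfl⟩; exact g.isUnit
  have hwd : ∫⁻ X in E, ((normAbs F X.det⁻¹ : ℝ≥0) : ℝ≥0∞) ^ Fintype.card (Fin 2) ∂μ𝔤 = 0 := by
    refine le_antisymm ?_ bot_le
    calc ∫⁻ X in E, ((normAbs F X.det⁻¹ : ℝ≥0) : ℝ≥0∞) ^ Fintype.card (Fin 2) ∂μ𝔤
        = ∫⁻ X in E, E.indicator (1 : Matrix (Fin 2) (Fin 2) F → ℝ≥0∞) X * ((normAbs F X.det⁻¹ : ℝ≥0) : ℝ≥0∞) ^ Fintype.card (Fin 2) ∂μ𝔤 := by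
          refine setLIntegral_congr_fun hEm fun X hX => ?_
          rw [indicator_of_mem hX, Pi.one_apply, one_mul]
      _ ≤ ∫⁻ X in {X : Matrix (Fin 2) (Fin 2) F | IsUnit X}, E.indicator (1 : Matrix (Fin 2) (Fin 2) F → ℝ≥0∞) X *
            ((normAbs F X.det⁻¹ : ℝ≥0) : ℝ≥0∞) ^ Fintype.card (Fin 2) ∂μ𝔤 := lintegral_mono_set hEunit
      _ = 0 := hR
  have hd : (μ𝔤.withDensity fun X => ((normAbs F X.det⁻¹ : ℝ≥0) : ℝ≥0∞) ^ Fintype.card (Fin 2)) E = 0 := by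
    rw [withDensity_apply _ hEm, hwd]
  rw [withDensity_apply_eq_zero measurable_glDensity] at hd
  have hsub : E ⊆ {X : Matrix (Fin 2) (Fin 2) F | ((normAbs F X.det⁻¹ : ℝ≥0) : ℝ≥0∞) ^ Fintype.card (Fin 2) ≠ 0} ∩ E :=
    fun X hX => ⟨glDensity_ne_zero_of_isUnit (hEunit hX), hX⟩
  exact measure_mono_null hsub hd

/-- **From a (nsc-K𝔟-MU)-type identity to the null-set form `hMU`**: if for every measurable `g ≥ 0`,
`∫_T ∫_N g(↑(t u)) dμ_N dν_T = c · ∫ 1_{S₀}(r) g(b(r)) ρ(r) dr` (ANY constant `c`, carrier `S₀` and density `ρ` — e.g. `c‖r₀‖⁻²‖r₂‖⁻¹` on `{r₀r₂ ≠ 0}`,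
the left Haar measure of the Borel of `GL₂`), then `dx³{r | b(r) ∈ E} = 0 ⇒ (ν_T ⊗ μ_N){(t,u) | ↑(t u) ∈ E} = 0`. [cite: HarishChandra1970, Part V §4 Lemma 22] [cite: WeilBNT1967, Ch. II §5] -/
theorem prod_null_of_lintegral_mul_eq (νT : Measure ↥(standardLeviGL F (id : Fin 2 → Fin 2))) (μN : Measure ↥(unipotentRadicalGL F (id : Fin 2 → Fin 2))) [SFinite μN]
    (dx : Measure F) {c : ℝ≥0∞} {S₀ : Set (Fin 3 → F)} {ρ : (Fin 3 → F) → ℝ≥0∞}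
    (hMUid : ∀ g : Matrix (Fin 2) (Fin 2) F → ℝ≥0∞, Measurable g →
      ∫⁻ t, ∫⁻ u, g (((t : GL (Fin 2) F) * (u : GL (Fin 2) F) : GL (Fin 2) F) : Matrix (Fin 2) (Fin 2) F) ∂μN ∂νT =
        c * ∫⁻ r : Fin 3 → F, S₀.indicator (fun r => g !![r 0, r 1; 0, r 2] * ρ r) r ∂(Measure.pi fun _ : Fin 3 => dx))
    {E : Set (Matrix (Fin 2) (Fin 2) F)} (hE : MeasurableSet E)
    (hE0 : (Measure.pi fun _ : Fin 3 => dx) {r : Fin 3 → F | (!![r 0, r 1; 0, r 2] : Matrix (Fin 2) (Fin 2) F) ∈ E} = 0) :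
    (νT.prod μN) {p | (((p.1 : GL (Fin 2) F) * (p.2 : GL (Fin 2) F) : GL (Fin 2) F) : Matrix (Fin 2) (Fin 2) F) ∈ E} = 0 := by
  classical
  haveI : T2Space F := (isLocalField F).toT2Space
  haveI : SecondCountableTopology F := secondCountableTopology_localField F
  haveI : IsTopologicalRing F := inferInstance
  haveI : SecondCountableTopology (Matrix (Fin 2) (Fin 2) F) := inferInstanceAs (SecondCountableTopology (Fin 2 → Fin 2 → F))
  haveI : SecondCountableTopology (Matrix (Fin 2) (Fin 2) F)ᵐᵒᵖ := MulOpposite.opHomeomorph.symm.secondCountableTopology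
  haveI : SecondCountableTopology (GL (Fin 2) F) := Units.isEmbedding_embedProduct.secondCountableTopology
  haveI : SecondCountableTopology ↥(standardLeviGL F (id : Fin 2 → Fin 2)) := TopologicalSpace.Subtype.secondCountableTopology _
  haveI : SecondCountableTopology ↥(unipotentRadicalGL F (id : Fin 2 → Fin 2)) := TopologicalSpace.Subtype.secondCountableTopology _
  haveI : BorelSpace ↥(standardLeviGL F (id : Fin 2 → Fin 2)) := Subtype.borelSpace _
  haveI : BorelSpace ↥(unipotentRadicalGL F (id : Fin 2 → Fin 2)) := Subtype.borelSpace _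
  have hmul : Measurable fun p : ↥(standardLeviGL F (id : Fin 2 → Fin 2)) × ↥(unipotentRadicalGL F (id : Fin 2 → Fin 2)) =>
      (((p.1 : GL (Fin 2) F) * (p.2 : GL (Fin 2) F) : GL (Fin 2) F) : Matrix (Fin 2) (Fin 2) F) :=
    (Units.continuous_val.comp ((continuous_subtype_val.comp continuous_fst).mul (continuous_subtype_val.comp continuous_snd))).measurable
  set S : Set (↥(standardLeviGL F (id : Fin 2 → Fin 2)) × ↥(unipotentRadicalGL F (id : Fin 2 → Fin 2))) :=
    {p | (((p.1 : GL (Fin 2) F) * (p.2 : GL (Fin 2) F) : GL (Fin 2) F) : Matrix (Fin 2) (Fin 2) F) ∈ E} with hS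
  have hSm : MeasurableSet S := hE.preimage hmul
  -- the left-hand side at `g = 1_E` is the product measure of `S`
  have hL : ∫⁻ t, ∫⁻ u, E.indicator (1 : Matrix (Fin 2) (Fin 2) F → ℝ≥0∞)
      (((t : GL (Fin 2) F) * (u : GL (Fin 2) F) : GL (Fin 2) F) : Matrix (Fin 2) (Fin 2) F) ∂μN ∂νT = (νT.prod μN) S := by
    rw [← lintegral_indicator_one hSm, lintegral_prod _ ((measurable_one.indicator hSm).aemeasurable)]
    refine lintegral_congr fun t => lintegral_congr fun u => ?_
    exact (Set.indicator_comp_right (fun p : ↥(standardLeviGL F (id : Fin 2 → Fin 2)) × ↥(unipotentRadicalGL F (id : Fin 2 → Fin 2)) =>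
      (((p.1 : GL (Fin 2) F) * (p.2 : GL (Fin 2) F) : GL (Fin 2) F) : Matrix (Fin 2) (Fin 2) F)) (g := (1 : Matrix (Fin 2) (Fin 2) F → ℝ≥0∞)) (x := (t, u)))
  -- the right-hand side vanishes: its integrand is supported in the `dx⁶`-null set `{r | b(r) ∈ E}`
  have hR : ∫⁻ r : Fin 3 → F, S₀.indicator (fun r => E.indicator (1 : Matrix (Fin 2) (Fin 2) F → ℝ≥0∞) !![r 0, r 1; 0, r 2] * ρ r) r
      ∂(Measure.pi fun _ : Fin 3 => dx) = 0 := by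
    refine le_antisymm ?_ bot_le
    calc ∫⁻ r : Fin 3 → F, S₀.indicator (fun r => E.indicator (1 : Matrix (Fin 2) (Fin 2) F → ℝ≥0∞) !![r 0, r 1; 0, r 2] * ρ r) r
          ∂(Measure.pi fun _ : Fin 3 => dx)
        ≤ ∫⁻ r : Fin 3 → F, {r : Fin 3 → F | (!![r 0, r 1; 0, r 2] : Matrix (Fin 2) (Fin 2) F) ∈ E}.indicator ρ r
            ∂(Measure.pi fun _ : Fin 3 => dx) := by
          refine lintegral_mono fun r => ?_
          by_cases hr : (!![r 0, r 1; 0, r 2] : Matrix (Fin 2) (Fin 2) F) ∈ E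
          · rw [indicator_of_mem (show r ∈ {r : Fin 3 → F | (!![r 0, r 1; 0, r 2] : Matrix (Fin 2) (Fin 2) F) ∈ E} from hr)]
            by_cases hr0 : r ∈ S₀
            · rw [indicator_of_mem hr0, indicator_of_mem hr, Pi.one_apply, one_mul]
            · rw [indicator_of_notMem hr0]; exact bot_le
          · by_cases hr0 : r ∈ S₀
            · rw [indicator_of_mem hr0, indicator_of_notMem hr, zero_mul]; exact bot_le
            · rw [indicator_of_notMem hr0]; exact bot_le
      _ = ∫⁻ r in {r : Fin 3 → F | (!![r 0, r 1; 0, r 2] : Matrix (Fin 2) (Fin 2) F) ∈ E}, ρ r ∂(Measure.pi fun _ : Fin 3 => dx) := by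
          have hbm : Measurable fun r : Fin 3 → F => (!![r 0, r 1; 0, r 2] : Matrix (Fin 2) (Fin 2) F) := by
            refine Continuous.measurable (continuous_matrix fun i j => ?_)
            fin_cases i <;> fin_cases j <;> simp <;> fun_prop
          exact lintegral_indicator (hE.preimage hbm) _
      _ = 0 := by rw [Measure.restrict_eq_zero.2 hE0, lintegral_zero_measure]
  have h := hMUid (E.indicator 1) (measurable_one.indicator hE)
  rw [hL, hR, mul_zero] at h
  exact h

/-- **(AC) SHAPE AT `N = 2`: THE BOREL KMU PUSH-FORWARD OF `GL₂(F)` IS ABSOLUTELY CONTINUOUS.**  `κ` a Haar measure of `K = GL₂(𝒪)`, `ν_T`, `μ_N` measures on the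
diagonal torus `T = standardLeviGL F id` and on `N₂ = unipotentRadicalGL F id` whose product is carried by `(t, u) ↦ t u = b(r)` to a measure absolutely continuous
w.r.t. `dx^{⊗3}` in the slice coordinates `r` (`hMU`), `μ_G` a Haar measure of `GL₂(F)`, `2 ≠ 0` in `F`: for every measurable `A` with `μ_G(A) = 0`,
`(κ ⊗ (ν_T ⊗ μ_N)) {(k, t, u) | k⁻¹ · (t u) · k ∈ A} = 0` (van Dijk–KMU spelling).
[cite: HarishChandra1970, Part V §4 Lemma 22] [cite: vanDijk1972, Thm. p. 237] [cite: WeilBNT1967, Ch. II §5] -/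
theorem borelKMU_null_of_haar_null (h2 : (2 : F) ≠ 0) (κ : Measure ↥(glInt 2 F)) [IsHaarMeasure κ]
    (νT : Measure ↥(standardLeviGL F (id : Fin 2 → Fin 2))) (μN : Measure ↥(unipotentRadicalGL F (id : Fin 2 → Fin 2)))
    (dx : Measure F) [dx.IsAddHaarMeasure]
    (hMU : ∀ E : Set (Matrix (Fin 2) (Fin 2) F), MeasurableSet E →
      (Measure.pi fun _ : Fin 3 => dx) {r : Fin 3 → F | (!![r 0, r 1; 0, r 2] : Matrix (Fin 2) (Fin 2) F) ∈ E} = 0 →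
      (νT.prod μN) {p | (((p.1 : GL (Fin 2) F) * (p.2 : GL (Fin 2) F) : GL (Fin 2) F) : Matrix (Fin 2) (Fin 2) F) ∈ E} = 0)
    (μG : Measure (GL (Fin 2) F)) [μG.IsHaarMeasure] {A : Set (GL (Fin 2) F)} (hA : MeasurableSet A) (hA0 : μG A = 0) :
    (κ.prod (νT.prod μN)) {q : ↥(glInt 2 F) × (↥(standardLeviGL F (id : Fin 2 → Fin 2)) × ↥(unipotentRadicalGL F (id : Fin 2 → Fin 2))) |
      ((q.1 : GL (Fin 2) F))⁻¹ * (((q.2.1 : GL (Fin 2) F)) * (q.2.2 : GL (Fin 2) F)) * (q.1 : GL (Fin 2) F) ∈ A} = 0 := by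
  classical
  -- §0 frame
  haveI : T2Space F := (isLocalField F).toT2Space
  haveI : LocallyCompactSpace F := (isLocalField F).toLocallyCompactSpace
  haveI : SecondCountableTopology F := secondCountableTopology_localField F
  haveI : IsTopologicalRing F := inferInstance
  haveI : T2Space (GL (Fin 2) F) := t2Space_generalLinearGroup F 2
  haveI : T2Space (Matrix (Fin 2) (Fin 2) F) := inferInstanceAs (T2Space (Fin 2 → Fin 2 → F))
  haveI : SecondCountableTopology (Matrix (Fin 2) (Fin 2) F) := inferInstanceAs (SecondCountableTopology (Fin 2 → Fin 2 → F))
  haveI : LocallyCompactSpace (Matrix (Fin 2) (Fin 2) F) := Pi.locallyCompactSpace_of_finite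
  haveI : SecondCountableTopology (Matrix (Fin 2) (Fin 2) F)ᵐᵒᵖ := MulOpposite.opHomeomorph.symm.secondCountableTopology
  haveI : SecondCountableTopology (GL (Fin 2) F) := Units.isEmbedding_embedProduct.secondCountableTopology
  haveI : SecondCountableTopology ↥(glInt 2 F) := TopologicalSpace.Subtype.secondCountableTopology _
  haveI : SecondCountableTopology ↥(standardLeviGL F (id : Fin 2 → Fin 2)) := TopologicalSpace.Subtype.secondCountableTopology _
  haveI : SecondCountableTopology ↥(unipotentRadicalGL F (id : Fin 2 → Fin 2)) := TopologicalSpace.Subtype.secondCountableTopology _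
  haveI : BorelSpace ↥(glInt 2 F) := Subtype.borelSpace _
  haveI : BorelSpace ↥(standardLeviGL F (id : Fin 2 → Fin 2)) := Subtype.borelSpace _
  haveI : BorelSpace ↥(unipotentRadicalGL F (id : Fin 2 → Fin 2)) := Subtype.borelSpace _
  haveI : CompactSpace ↥(glInt 2 F) := isCompact_iff_compactSpace.1 (isCompact_glInt (n := 2) (F := F))
  haveI : κ.IsInvInvariant := Literature.MeasureTheory.Group.HaarLocalChart.isInvInvariant_of_isHaarMeasure κ
  haveI : SFinite (Measure.pi fun _ : Fin 3 => dx) := inferInstance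
  have hme : MeasurableEmbedding (Units.val : GL (Fin 2) F → Matrix (Fin 2) (Fin 2) F) := measurableEmbedding_generalLinearGroup_val
  -- the chart `y ↦ [[y₁,y₂],[y₀,y₃]]` of `M₂(F)` and the additive Haar measure it carries from `dx^{⊗4}`
  let M : (Fin 4 → F) ≃+ Matrix (Fin 2) (Fin 2) F :=
    { toFun := fun y => !![y 1, y 2; y 0, y 3]
      invFun := fun X => ![X 1 0, X 0 0, X 0 1, X 1 1]
      left_inv := fun y => by
        ext i
        fin_cases i <;> rfl
      right_inv := fun X => by
        ext i j
        fin_cases i <;> fin_cases j <;> rfl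
      map_add' := fun y y' => by
        ext i j
        fin_cases i <;> fin_cases j <;> rfl }
  have hM : ∀ y : Fin 4 → F, M y = !![y 1, y 2; y 0, y 3] := fun y => rfl
  have hMc : Continuous M := by
    refine continuous_matrix fun i j => ?_
    fin_cases i <;> fin_cases j <;> exact continuous_apply _
  have hMsc : Continuous M.symm := by
    refine continuous_pi fun i => ?_
    fin_cases i
    · exact (continuous_apply (0 : Fin 2)).comp (continuous_apply (1 : Fin 2))
    · exact (continuous_apply (0 : Fin 2)).comp (continuous_apply (0 : Fin 2))
    · exact (continuous_apply (1 : Fin 2)).comp (continuous_apply (0 : Fin 2))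
    · exact (continuous_apply (1 : Fin 2)).comp (continuous_apply (1 : Fin 2))
  set μ𝔤 : Measure (Matrix (Fin 2) (Fin 2) F) := (Measure.pi fun _ : Fin 4 => dx).map M with hμ𝔤
  haveI : μ𝔤.IsAddHaarMeasure := by rw [hμ𝔤]; exact AddEquiv.isAddHaarMeasure_map _ M hMc hMsc
  set E : Set (Matrix (Fin 2) (Fin 2) F) := Units.val '' A with hE
  have hEm : MeasurableSet E := hme.measurableSet_image.2 hA
  have hE0 : μ𝔤 E = 0 := addHaar_image_val_eq_zero_of_haar_eq_zero μ𝔤 μG hA hA0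
  have hE0' : (Measure.pi fun _ : Fin 4 => dx) ((fun y : Fin 4 → F => (!![y 1, y 2; y 0, y 3] : Matrix (Fin 2) (Fin 2) F)) ⁻¹' E) = 0 := by
    rw [hμ𝔤, Measure.map_apply hMc.measurable hEm] at hE0
    exact hE0
  -- §1 the Borel-slice identity against `1_E`: `∫_K dx³{r | k b(r) k⁻¹ ∈ E} dκ = 0`
  obtain ⟨c, -, -, hid⟩ := K2E3GL2BorelSliceKIntegral.lintegral_glInt_sliceFunctional_eq dx h2 κ
  set Φ : ↥(glInt 2 F) → ℝ≥0∞ := fun k => ∫⁻ r : Fin 3 → F,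
    E.indicator (1 : Matrix (Fin 2) (Fin 2) F → ℝ≥0∞) (((k : GL (Fin 2) F) : Matrix (Fin 2) (Fin 2) F) * !![r 0, r 1; 0, r 2] *
      ((((k : GL (Fin 2) F))⁻¹ : GL (Fin 2) F) : Matrix (Fin 2) (Fin 2) F)) ∂(Measure.pi fun _ : Fin 3 => dx) with hΦ
  have hjoint : Measurable fun p : ↥(glInt 2 F) × (Fin 3 → F) =>
      ((p.1 : GL (Fin 2) F) : Matrix (Fin 2) (Fin 2) F) * !![p.2 0, p.2 1; 0, p.2 2] *
        ((((p.1 : GL (Fin 2) F))⁻¹ : GL (Fin 2) F) : Matrix (Fin 2) (Fin 2) F) := by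
    refine Continuous.measurable ?_
    refine (((Units.continuous_val.comp (continuous_subtype_val.comp continuous_fst))).mul ?_).mul
      (Units.continuous_coe_inv.comp (continuous_subtype_val.comp continuous_fst))
    refine continuous_matrix fun i j => ?_
    fin_cases i <;> fin_cases j <;> simp <;> fun_prop
  have hΦm : Measurable Φ := ((measurable_one.indicator hEm).comp hjoint).lintegral_prod_right'
  have hchart : Measurable fun y : Fin 4 → F => (!![y 1, y 2; y 0, y 3] : Matrix (Fin 2) (Fin 2) F) := hMc.measurable
  have hΦ0 : ∫⁻ k, Φ k ∂κ = 0 := by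
    rw [hΦ, hid (E.indicator 1) (measurable_one.indicator hEm)]
    refine mul_eq_zero_of_right _ (le_antisymm ?_ bot_le)
    calc ∫⁻ y : Fin 4 → F, {D : F | IsSquare D ∧ D ≠ 0}.indicator (fun D => (((NNReal.sqrt (normAbs F D))⁻¹ : ℝ≥0) : ℝ≥0∞))
            ((!![y 1, y 2; y 0, y 3] : Matrix (Fin 2) (Fin 2) F)).charpoly.discr *
            E.indicator (1 : Matrix (Fin 2) (Fin 2) F → ℝ≥0∞) !![y 1, y 2; y 0, y 3] ∂(Measure.pi fun _ : Fin 4 => dx)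
        ≤ ∫⁻ y : Fin 4 → F, ((fun y : Fin 4 → F => (!![y 1, y 2; y 0, y 3] : Matrix (Fin 2) (Fin 2) F)) ⁻¹' E).indicator
            (fun y => (((NNReal.sqrt (normAbs F ((!![y 1, y 2; y 0, y 3] : Matrix (Fin 2) (Fin 2) F)).charpoly.discr))⁻¹ : ℝ≥0) : ℝ≥0∞)) y
            ∂(Measure.pi fun _ : Fin 4 => dx) := by
          refine lintegral_mono fun y => ?_
          by_cases hy : (!![y 1, y 2; y 0, y 3] : Matrix (Fin 2) (Fin 2) F) ∈ E
          · rw [indicator_of_mem (show y ∈ (fun y : Fin 4 → F => (!![y 1, y 2; y 0, y 3] : Matrix (Fin 2) (Fin 2) F)) ⁻¹' E from hy),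
              indicator_of_mem hy, Pi.one_apply, mul_one]
            by_cases hD : ((!![y 1, y 2; y 0, y 3] : Matrix (Fin 2) (Fin 2) F)).charpoly.discr ∈ {D : F | IsSquare D ∧ D ≠ 0}
            · rw [indicator_of_mem hD]
            · rw [indicator_of_notMem hD]; exact bot_le
          · rw [indicator_of_notMem hy, mul_zero]; exact bot_le
      _ = ∫⁻ y in (fun y : Fin 4 → F => (!![y 1, y 2; y 0, y 3] : Matrix (Fin 2) (Fin 2) F)) ⁻¹' E,
            (((NNReal.sqrt (normAbs F ((!![y 1, y 2; y 0, y 3] : Matrix (Fin 2) (Fin 2) F)).charpoly.discr))⁻¹ : ℝ≥0) : ℝ≥0∞) ∂(Measure.pi fun _ : Fin 4 => dx) :=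
          lintegral_indicator (hEm.preimage hchart) _
      _ = 0 := by rw [Measure.restrict_eq_zero.2 hE0', lintegral_zero_measure]
  have hΦae : Φ =ᵐ[κ] 0 := (lintegral_eq_zero_iff hΦm).1 hΦ0
  -- membership in `A` read on matrices
  have hmemE : ∀ g : GL (Fin 2) F, (g : Matrix (Fin 2) (Fin 2) F) ∈ E ↔ g ∈ A := fun g =>
    ⟨fun ⟨g', hg', hgg'⟩ => Units.ext hgg' ▸ hg', fun hg => ⟨g, hg, rfl⟩⟩
  -- §2 the conjugated sets `E_k = {X | k X k⁻¹ ∈ E}` and `hMU`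
  have hbm : Measurable fun r : Fin 3 → F => (!![r 0, r 1; 0, r 2] : Matrix (Fin 2) (Fin 2) F) := by
    refine Continuous.measurable (continuous_matrix fun i j => ?_)
    fin_cases i <;> fin_cases j <;> simp <;> fun_prop
  have hconj : ∀ k : ↥(glInt 2 F), Φ k = 0 →
      (νT.prod μN) {p : ↥(standardLeviGL F (id : Fin 2 → Fin 2)) × ↥(unipotentRadicalGL F (id : Fin 2 → Fin 2)) |
        (((k : GL (Fin 2) F) * ((p.1 : GL (Fin 2) F) * (p.2 : GL (Fin 2) F)) * ((k : GL (Fin 2) F))⁻¹ : GL (Fin 2) F) : Matrix (Fin 2) (Fin 2) F) ∈ E} = 0 := by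
    intro k hk
    -- the conjugation by `k` on matrices and the conjugated set `E_k`
    have hck : Continuous fun X : Matrix (Fin 2) (Fin 2) F => ((k : GL (Fin 2) F) : Matrix (Fin 2) (Fin 2) F) * X *
        ((((k : GL (Fin 2) F))⁻¹ : GL (Fin 2) F) : Matrix (Fin 2) (Fin 2) F) := (continuous_const.mul continuous_id).mul continuous_const
    have hEkm : MeasurableSet ((fun X : Matrix (Fin 2) (Fin 2) F => ((k : GL (Fin 2) F) : Matrix (Fin 2) (Fin 2) F) * X *
        ((((k : GL (Fin 2) F))⁻¹ : GL (Fin 2) F) : Matrix (Fin 2) (Fin 2) F)) ⁻¹' E) := hEm.preimage hck.measurable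
    -- its slice preimage is `dx⁶`-null: it has measure `Φ k = 0`
    have hpre_m : MeasurableSet ((fun r : Fin 3 → F => ((k : GL (Fin 2) F) : Matrix (Fin 2) (Fin 2) F) * !![r 0, r 1; 0, r 2] *
        ((((k : GL (Fin 2) F))⁻¹ : GL (Fin 2) F) : Matrix (Fin 2) (Fin 2) F)) ⁻¹' E) := hEm.preimage (hck.measurable.comp hbm)
    have hΦk : Φ k = (Measure.pi fun _ : Fin 3 => dx) ((fun r : Fin 3 → F => ((k : GL (Fin 2) F) : Matrix (Fin 2) (Fin 2) F) *
        !![r 0, r 1; 0, r 2] * ((((k : GL (Fin 2) F))⁻¹ : GL (Fin 2) F) : Matrix (Fin 2) (Fin 2) F)) ⁻¹' E) := by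
      rw [hΦ, ← lintegral_indicator_one hpre_m]
      refine lintegral_congr fun r => ?_
      exact (Set.indicator_comp_right (fun r : Fin 3 → F => ((k : GL (Fin 2) F) : Matrix (Fin 2) (Fin 2) F) *
        !![r 0, r 1; 0, r 2] * ((((k : GL (Fin 2) F))⁻¹ : GL (Fin 2) F) : Matrix (Fin 2) (Fin 2) F)) (g := (1 : Matrix (Fin 2) (Fin 2) F → ℝ≥0∞))).symm
    have hnull : (Measure.pi fun _ : Fin 3 => dx) {r : Fin 3 → F | (!![r 0, r 1; 0, r 2] : Matrix (Fin 2) (Fin 2) F) ∈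
        (fun X : Matrix (Fin 2) (Fin 2) F => ((k : GL (Fin 2) F) : Matrix (Fin 2) (Fin 2) F) * X *
          ((((k : GL (Fin 2) F))⁻¹ : GL (Fin 2) F) : Matrix (Fin 2) (Fin 2) F)) ⁻¹' E} = 0 := by
      rw [← hk, hΦk]
      rfl
    have h := hMU _ hEkm hnull
    have hset_eq : {p : ↥(standardLeviGL F (id : Fin 2 → Fin 2)) × ↥(unipotentRadicalGL F (id : Fin 2 → Fin 2)) |
          (((p.1 : GL (Fin 2) F) * (p.2 : GL (Fin 2) F) : GL (Fin 2) F) : Matrix (Fin 2) (Fin 2) F) ∈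
            (fun X : Matrix (Fin 2) (Fin 2) F => ((k : GL (Fin 2) F) : Matrix (Fin 2) (Fin 2) F) * X *
              ((((k : GL (Fin 2) F))⁻¹ : GL (Fin 2) F) : Matrix (Fin 2) (Fin 2) F)) ⁻¹' E} =
        {p | (((k : GL (Fin 2) F) * ((p.1 : GL (Fin 2) F) * (p.2 : GL (Fin 2) F)) * ((k : GL (Fin 2) F))⁻¹ : GL (Fin 2) F) : Matrix (Fin 2) (Fin 2) F) ∈ E} := by
      ext p
      simp only [mem_setOf_eq, mem_preimage, Units.val_mul]
    rw [hset_eq] at h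
    exact h
  -- §3 the target set, its sections, and Tonelli
  set Q : Set (↥(glInt 2 F) × (↥(standardLeviGL F (id : Fin 2 → Fin 2)) × ↥(unipotentRadicalGL F (id : Fin 2 → Fin 2)))) :=
    {q | ((q.1 : GL (Fin 2) F))⁻¹ * (((q.2.1 : GL (Fin 2) F)) * (q.2.2 : GL (Fin 2) F)) * (q.1 : GL (Fin 2) F) ∈ A} with hQ
  have hQm : MeasurableSet Q := by
    refine hA.preimage (Continuous.measurable ?_)
    have h1 : Continuous fun q : ↥(glInt 2 F) × (↥(standardLeviGL F (id : Fin 2 → Fin 2)) × ↥(unipotentRadicalGL F (id : Fin 2 → Fin 2))) =>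
        (q.1 : GL (Fin 2) F) := continuous_subtype_val.comp continuous_fst
    have h2 : Continuous fun q : ↥(glInt 2 F) × (↥(standardLeviGL F (id : Fin 2 → Fin 2)) × ↥(unipotentRadicalGL F (id : Fin 2 → Fin 2))) =>
        (q.2.1 : GL (Fin 2) F) := continuous_subtype_val.comp (continuous_fst.comp continuous_snd)
    have h3 : Continuous fun q : ↥(glInt 2 F) × (↥(standardLeviGL F (id : Fin 2 → Fin 2)) × ↥(unipotentRadicalGL F (id : Fin 2 → Fin 2))) =>
        (q.2.2 : GL (Fin 2) F) := continuous_subtype_val.comp (continuous_snd.comp continuous_snd)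
    exact (h1.inv.mul (h2.mul h3)).mul h1
  -- `κ`-a.e. `k` has `Φ k⁻¹ = 0` (inversion invariance of `κ`)
  have hΦinv : ∀ᵐ k ∂κ, Φ k⁻¹ = 0 := by
    rw [ae_iff]
    have hset : {k : ↥(glInt 2 F) | ¬ Φ k⁻¹ = 0} = {k : ↥(glInt 2 F) | ¬ Φ k = 0}⁻¹ := by
      ext k; simp only [mem_setOf_eq, Set.mem_inv]
    have h0 : κ {k : ↥(glInt 2 F) | ¬ Φ k = 0} = 0 := by rw [← ae_iff]; exact hΦae
    rw [hset, ← Measure.inv_apply, Measure.inv_eq_self, h0]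
  refine measure_prod_null_of_ae_null hQm ?_
  filter_upwards [hΦinv] with k hk
  have h := hconj k⁻¹ hk
  have hsec : Prod.mk k ⁻¹' Q = {p : ↥(standardLeviGL F (id : Fin 2 → Fin 2)) × ↥(unipotentRadicalGL F (id : Fin 2 → Fin 2)) |
      ((((k⁻¹ : ↥(glInt 2 F)) : GL (Fin 2) F) * ((p.1 : GL (Fin 2) F) * (p.2 : GL (Fin 2) F)) * (((k⁻¹ : ↥(glInt 2 F)) : GL (Fin 2) F))⁻¹ : GL (Fin 2) F) :
        Matrix (Fin 2) (Fin 2) F) ∈ E} := by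
    ext p
    simp only [hQ, mem_preimage, mem_setOf_eq, hmemE, InvMemClass.coe_inv, inv_inv]
  rw [hsec]
  exact h

end Summit.HodgeConjecture.HodgeConjecture.Cruxes.H413.K2E3GL2BorelKMUDomination

end
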